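import Summits.FinalStateConjecture.FinalStateConjecture.Theorems.ZeroEnergyKerrOrBombStationaryLimitReductionRecutCoveringJunctionCore
import Literature.Geometry.Lorentzian.KerrSchildCoord
import Literature.Geometry.Lorentzian.KerrTimelikeSpan
import Literature.Geometry.Lorentzian.KerrWaveEnergy
import Summits.FinalStateConjecture.FinalStateConjecture.Theorems.ZeroEnergyKerrOrBombKerrZeroEnergyUntrappedKSPointwise
import HarnessLib

/-!
# Route ZeroEnergyKerrOrBomb · crux `FinalStateFromKerrOrBomb` (stmt-FinalStateConjecture-17839), line
# `SketchIdeator1` — stub `stub_recutJunctionCoreOriented`, ingredient (α) in the ergoregion: the uniform DRSR margin,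
# and the slab conclusion for the far-ness predicate `r ≥ r₊ + δ`

Helper file (`--supports stmt-FinalStateConjecture-17839`; registered helpers `kerr_drsrVector_uniform`,
`recutJunction_holeTube_rPlus_slab`) of the lead's wave-3 stub worker (2026-08-17); companion of
`…FinalStateFromKerrOrBombRecutJunctionHoleTube.lean` (p141608, flow of `∂_{t*}` outside the ergoregion),
`…RecutJunctionPastBoundary.lean` (p141631) and `…RecutJunctionHoleTubeErgo.lean` (helical flow `T + ω(r)Φ` on
`{r₊ + δ ≤ r ≤ R_m}`, proposed the same day).

* §1 `kerr_drsrVector_uniform`: for sub-extremal `(M, a)`, `δ > 0`, `R_m`, there are `m > 0`, `K_V ≥ 0` with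
  `g_{M,a}(x)(V_ω, V_ω) ≤ −m` and `‖V_ω(x)‖ ≤ K_V` whenever `r₊ + δ ≤ r(x) ≤ R_m`, `V_ω = T + (2Mar/(r² + a²)²) Φ` the
  vector of Dafermos–Rodnianski–Shlapentokh-Rothman, Lemma 4.7.1 (pointwise timelike on the exterior: the tree's
  `Kerr.bilin_drsrVector_neg`; uniformity by compactness of the slab piece `{t* = 0, r₊ + δ ≤ r ≤ R_m}` and
  `t*`-invariance). This is the hypothesis `hunif` of `recutJunction_holeTube_ergo_slab` (helical-flow file).
* §2 `recutJunction_holeTube_rPlus_slab`: the slab conclusions of the two flow files — outside the ergoregion with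
  margin (`2H ≤ 1 − δ'`, p141608) and on `{r₊ + δ ≤ r ≤ R_m}` (helical file) — taken as hypotheses (both modules are
  unbuilt today) give the slab conclusion for the far-ness predicate `F i x := r₊ + δ ≤ r(x)` (`R_m = 8M`,
  `δ' = 3/4`: `2H ≤ 2M/r ≤ 1/4` for `r ≥ 8M`), i.e. the input `hα` of `recutJunction_farTubes_diff_subset` (p141631)
  for the hole-tube points of Kerr–Schild radius `≥ r₊ + δ`.

Elementary; no named fact, nothing restated. References: Dafermos–Rodnianski–Shlapentokh-Rothman arXiv:1402.7034,
Lemma 4.7.1; Dafermos–Luk arXiv:1710.01722, Conjecture 1 (b)–(c).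
-/

set_option linter.dupNamespace false

noncomputable section

open scoped Manifold ContDiff Topology ENNReal
open Set Filter Function Literature.Geometry.Lorentzian

namespace Summit.FinalStateConjecture.FinalStateConjecture.Theorems.SymplecticDualOfTheBomb

open Summit.FinalStateConjecture.FinalStateConjecture.Theorems.OneLockedExplosion

/-! ## §1 Uniform margin and size of the DRSR vector on `{r₊ + δ ≤ r ≤ R_m}` -/

section Uniform

/-- The DRSR vector field is continuous on `{r > 0}` (rational in `(x, r)`). [folklore] -/
theorem continuousOn_drsrVector (M a : ℝ) :
    ContinuousOn (fun x ↦ Kerr.drsrVector M a x) {x : E4 | 0 < Kerr.radius a x} := by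
  have hr : Continuous (Kerr.radius a) := Kerr.continuous_radius a
  have hax : Continuous fun x : E4 ↦ Kerr.axialVector x :=
    (((EuclideanSpace.proj (𝕜 := ℝ) (1 : Fin 4)).continuous).smul continuous_const).sub
      (((EuclideanSpace.proj (𝕜 := ℝ) (2 : Fin 4)).continuous).smul continuous_const)
  have hω : ContinuousOn (fun x : E4 ↦ Kerr.drsrAngularVelocity M a (Kerr.radius a x)) {x : E4 | 0 < Kerr.radius a x} := by
    unfold Kerr.drsrAngularVelocity
    refine ((continuous_const.mul hr).continuousOn).div (((hr.pow 2).add continuous_const).pow 2).continuousOn ?_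
    intro x hx
    have : 0 < Kerr.radius a x := hx
    positivity
  exact continuousOn_const.add (hω.smul hax.continuousOn)

/-- **Registered helper `kerr_drsrVector_uniform` — uniform margin and size of the DRSR vector.** For sub-extremal
`(M, a)`, `δ > 0` and `R_m` there are `m > 0` and `K_V ≥ 0` with `g_{M,a}(x)(V_ω, V_ω) ≤ −m` and `‖V_ω(x)‖ ≤ K_V` at
every `x` with `r₊ + δ ≤ r(x) ≤ R_m` (DRSR Lemma 4.7.1 pointwise, compactness of the slab piece
`{t* = 0, r₊ + δ ≤ r ≤ R_m}`, time invariance). [folklore] -/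
theorem kerr_drsrVector_uniform : ∀ (M a : ℝ), Kerr.IsSubextremal M a → ∀ (δ Rm : ℝ), 0 < δ → ∃ m KV : ℝ, 0 < m ∧ 0 ≤ KV ∧ ∀ x : E4, Kerr.rPlus M a + δ ≤ Kerr.radius a x → Kerr.radius a x ≤ Rm → Kerr.bilin M a x (Kerr.drsrVector M a x) (Kerr.drsrVector M a x) ≤ -m ∧ ‖Kerr.drsrVector M a x‖ ≤ KV := by
  intro M a hMa δ Rm hδ
  have hrp : 0 < Kerr.rPlus M a := hMa.pos.trans_le (le_add_of_nonneg_right (Real.sqrt_nonneg _))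
  set K : Set E4 := {x | E4.time x = 0 ∧ Kerr.rPlus M a + δ ≤ Kerr.radius a x ∧ Kerr.radius a x ≤ Rm} with hK
  have hKc : IsCompact K := isCompact_kerrSlabPiece a (by linarith) Rm
  have hKpos : K ⊆ {x : E4 | 0 < Kerr.radius a x} := fun x hx ↦ by
    show 0 < Kerr.radius a x; linarith [hx.2.1]
  set f : E4 → ℝ := fun x ↦ Kerr.bilin M a x (Kerr.drsrVector M a x) (Kerr.drsrVector M a x) with hf
  have hVc := continuousOn_drsrVector M a
  have hfc : ContinuousOn f {x : E4 | 0 < Kerr.radius a x} := by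
    intro x hx
    have hb := (Kerr.contDiffAt_bilin M a hx (n := 0)).continuousAt
    have hV := hVc.continuousAt ((isOpen_lt continuous_const (Kerr.continuous_radius a)).mem_nhds hx)
    exact ((hb.clm_apply hV).clm_apply hV).continuousWithinAt
  -- the margin
  obtain ⟨m, hm0, hm⟩ : ∃ m : ℝ, 0 < m ∧ ∀ x ∈ K, f x ≤ -m := by
    rcases K.eq_empty_or_nonempty with hKe | hKne
    · exact ⟨1, one_pos, fun x hx ↦ by rw [hKe] at hx; exact hx.elim⟩
    · obtain ⟨x₀, hx₀, hmax⟩ := hKc.exists_isMaxOn hKne (hfc.mono hKpos)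
      have hneg : f x₀ < 0 := Kerr.bilin_drsrVector_neg hMa (by linarith [hx₀.2.1])
      exact ⟨-f x₀, by linarith, fun x hx ↦ by have h : f x ≤ f x₀ := hmax hx; linarith⟩
  -- the size
  obtain ⟨KV, hKV⟩ := hKc.exists_bound_of_continuousOn (hVc.mono hKpos)
  refine ⟨m, max KV 0, hm0, le_max_right _ _, fun x hx1 hx2 ↦ ?_⟩
  -- reduce to the foot point `x - x⁰ e₀ ∈ K`
  have hfoot : x + (-(E4.time x)) • E4.basisVector 0 ∈ K := by
    refine ⟨?_, ?_, ?_⟩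
    · rw [time_add_smul_basisVector_zero]; ring
    · rw [Kerr.radius_add_time_smul_basisVector]; exact hx1
    · rw [Kerr.radius_add_time_smul_basisVector]; exact hx2
  have hV := KerrUntrapped.drsrVector_add_smul_basisVector_zero M a x (-(E4.time x))
  constructor
  · have h := hm _ hfoot
    simp only [hf, hV, Kerr.bilin_add_smul_basisVector_zero] at h
    exact h
  · have h := hKV _ hfoot
    rw [hV] at h
    exact h.trans (le_max_left _ _)

end Uniform

/-! ## §2 The slab conclusion for the far-ness predicate `r ≥ r₊ + δ` -/

/-- `2H ≤ 2M/r`: outside `r = 8M` the ergoregion margin `2H ≤ 1/4` holds (`H = Mr³/(r⁴ + a²z²) ≤ M/r`). [folklore] -/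
theorem two_mul_scalarH_le_of_le_radius {M a : ℝ} (hM : 0 ≤ M) {x : E4} (hx : 0 < Kerr.radius a x)
    (h8 : 8 * M ≤ Kerr.radius a x) : 2 * Kerr.scalarH M a x ≤ 1 - 3 / 4 := by
  have h := Kerr.scalarH_le_div hM a hx
  have h2 : M / Kerr.radius a x ≤ 1 / 8 := by
    rw [div_le_div_iff₀ hx (by norm_num : (0 : ℝ) < 8)]; linarith
  linarith

/-- **Registered helper `recutJunction_holeTube_rPlus_slab` — the slab conclusion of ingredient (α) for ALL hole-tube points
of Kerr–Schild radius `≥ r₊ + δ`.** Hypotheses: `IsKerrChartedWith` and the slab conclusions of the two flow files (outside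
the ergoregion with margin `2H ≤ 1 − δ'`, p141608; on `{r₊ + δ ≤ r ≤ R_m}`, helical file), both unbuilt today and
therefore taken verbatim as hypotheses. Conclusion: the same slab statement for the far-ness predicate `r(x) ≥ r₊ + δ`
(`R_m = 8M` and `δ' = 3/4`), i.e. the input `hα` of `recutJunction_farTubes_diff_subset` with `F i x := r₊ + δ ≤ r(x)`.
[folklore] -/
theorem recutJunction_holeTube_rPlus_slab : ∀ {𝓢 : Spacetime.{0} 4} {O : Set 𝓢.carrier} {k : ℕ} (d : StationaryFinalStateDecomposition 𝓢 O k) (M a c r₀ : Fin d.N → ℝ) (Θ : Fin d.N → E4 → E4) (R : Fin d.N → ℝ → ℝ), (∀ i, IsKerrChartedWith (d.hole i) (d.adapted i) (M i) (a i) (c i) (r₀ i) (Θ i)) → (∀ (i : Fin d.N) (δ : ℝ), 0 < δ → ∃ T : ℝ, ∀ (R' : Fin d.N → ℝ → ℝ) (τ₁ : ℝ), ∀ x ∈ (Kerr.exterior (M i) (a i) : Set E4), 2 * Kerr.scalarH (M i) (a i) x ≤ 1 - δ → T ≤ Θ i x 0 → (d.adapted i).radius (Θ i x) ≤ R i (Θ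 i x 0) → x 0 ≤ τ₁ → Kerr.radius (a i) x ≤ R' i τ₁ → ∀ h₀ : ((d.motion i).1 : E4 ≃L[ℝ] E4) (Θ i x) + (d.motion i).2 ∈ (d.background i).domain, d.toOver.chart i ⟨((d.motion i).1 : E4 ≃L[ℝ] E4) (Θ i x) + (d.motion i).2, h₀⟩ ∈ 𝓢.metric.causalPast 𝓢.timeOrientation (recutCertifiedSlab d M a Θ R' τ₁)) → (∀ (i : Fin d.N) (δ Rm : ℝ), 0 < δ → ∃ T : ℝ, ∀ (R' : Fin d.N → ℝ → ℝ) (τ₁ : ℝ), ∀ x ∈ (Kerr.exterior (M i) (a i) : Set E4), Kerr.rPlus (M i) (a i) + δ ≤ Kerr.radius (a i) x → Kerr.radius (a i) x ≤ Rm → T ≤ Θ i x 0 → x 0 ≤ τ₁ → Kerr.radius (a i) x ≤ R' i τ₁ → ∀ h₀ : ((d.motion i).1 : E4 ≃L[ℝ] E4) (Θ i x) + (d.motion i).2 ∈ (d.background i).domain, d.toOver.chart i ⟨((d.motion i).1 : E4 ≃L[ℝ] E4) (Θ i x) + (d.motion i).2, h₀⟩ ∈ 𝓢.metric.causalPast 𝓢.timeOrientation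 (recutCertifiedSlab d M a Θ R' τ₁)) → ∀ (i : Fin d.N) (δ : ℝ), 0 < δ → ∃ T : ℝ, ∀ (R' : Fin d.N → ℝ → ℝ) (τ₁ : ℝ), ∀ x ∈ (Kerr.exterior (M i) (a i) : Set E4), Kerr.rPlus (M i) (a i) + δ ≤ Kerr.radius (a i) x → T ≤ Θ i x 0 → (d.adapted i).radius (Θ i x) ≤ R i (Θ i x 0) → x 0 ≤ τ₁ → Kerr.radius (a i) x ≤ R' i τ₁ → ∀ h₀ : ((d.motion i).1 : E4 ≃L[ℝ] E4) (Θ i x) + (d.motion i).2 ∈ (d.background i).domain, d.toOver.chart i ⟨((d.motion i).1 : E4 ≃L[ℝ] E4) (Θ i x) + (d.motion i).2, h₀⟩ ∈ 𝓢.metric.causalPast 𝓢.timeOrientation (recutCertifiedSlab d M a Θ R' τ₁) := by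
  intro 𝓢 O k d M a c r₀ Θ R hW hfar hergo i δ hδ
  obtain ⟨T₁, hT₁⟩ := hfar i (3 / 4) (by norm_num)
  obtain ⟨T₂, hT₂⟩ := hergo i δ (8 * M i) hδ
  refine ⟨max T₁ T₂, fun R' τ₁ x hx hδx hT hRx hx0 hrad h₀ ↦ ?_⟩
  by_cases h8 : Kerr.radius (a i) x ≤ 8 * M i
  · exact hT₂ R' τ₁ x hx hδx h8 ((le_max_right _ _).trans hT) hx0 hrad h₀
  · push Not at h8
    have hH := two_mul_scalarH_le_of_le_radius (hW i).1.pos.le (Kerr.radius_pos_of_mem_region hx) h8.le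
    exact hT₁ R' τ₁ x hx hH ((le_max_left _ _).trans hT) hRx hx0 hrad h₀

end Summit.FinalStateConjecture.FinalStateConjecture.Theorems.SymplecticDualOfTheBomb

end
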